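import Literature.Geometry.Kaehler.ComplexTorusCentralizerRosati
import Literature.Geometry.Kaehler.ComplexTorusHodgeGroupCommutative
import HarnessLib

/-!
# Milne 1999, §1 over `k = ℚ` (Betti) at torus level: Remark 1.2 (the centraliser of `C(A)` is `End⁰(A)`)
# and Proposition 1.3 (the skew forms compatible with `†` on `C(A)` are the `ℚ`-span of the `e_D`)

Layer `Literature/Geometry/Kaehler`, namespace `Literature.Geometry.Kaehler.ComplexTorus`; lane `lit-hodgefound`
(Track 2 foundations library), Layer A4 / A2-31, self-proposed row «Q155⁺ · Q198⁺ · A2-31⁺ · B5-23 (torus level,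
`k = ℚ`)» of `run/shared/lean/pub/lit-hodgefound/SKELETON.md`. Sequel of `ComplexTorusLefschetzGroupProduct.lean`
(Q155: Milne's algebra `C(A)` for `k = ℝ`, `endCentralizerAlg Φ` = the centraliser of `End_ℚ(X)` in `M_ι(ℝ)`), of
`ComplexTorusCentralizerRosati.lean` (Q198: `C(A)` is `†`-stable; `†|_{C(A)}` is independent of the polarisation),
of `ComplexTorusNeronSeveriEndomorphisms.lean` (A2-31: `NS_ℚ(X) = neronSeveriQ Φ`, rational Gram matrices
`ratGram`, `NS_ℚ(X) ≅ End^s_ℚ(X)` = Lange Prop. 2.4.12 = Mumford §21 p. 208: `nsToEnd`, `exists_nsToEnd_eq`) and of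
`ComplexTorusHodgeGroupCommutative.lean` §1 / §4 (rational descent: `mem_span_map_ratCast_centralizer_of_forall_commute`,
`jMatrix_mem_span_centralizer_endAlgRat`, `centralizer_le_endAlgRat_of_jMatrix_mem_span`). THEOREMS ONLY: no
definition, no named fact (net debt `0`).

## Source followed, verbatim

J. S. Milne, *Lefschetz classes on abelian varieties*, Duke Math. J. **96** (1999) 639–675, §1, held copy
`paper:doi-10-1215-s0012-7094-99-09620-5` (author's version, own folios; Duke page ≈ folio + 638):

* p0004 (p. 642), the table of Weil cohomologies: "`Ω = ℂ`, `k = ℚ`, `H^s(X(ℂ), ℚ)` — Betti cohomology", and "For an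
  abelian variety `A` over `Ω`, we define `V(A)` to be the dual of `H¹(A)`. For example, `V_B(A) = H₁(A(ℂ), ℚ)` […]
  A divisor `D` on `A` defines a class `cl(D)` in `H²(A)(1)` and, via the isomorphisms
  `H²(A)(1) ≅ (⋀² H¹(A))(1) ≅ Hom(⋀² V(A), k(1))`, a skew-symmetric pairing `e_D : V(A) × V(A) → k(1)`. When `D` is ample,
  `e_D` is nondegenerate, and we let `β†` denote the adjoint with respect to `e_D` of a `k`-linear endomorphism `β` of
  `V(A)`: `e_D(βx, y) = e_D(x, β†y)`, all `x, y ∈ V(A)`. Then `β ↦ β†` is an involution of the `k`-algebra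
  `End_k(V(A))` whose restriction to `End⁰(A)` is the Rosati involution defined by `D`. […] **The `k`-algebra `C(A)`.**
  For an abelian variety `A` over `Ω`, we define `C(A)` to be the centralizer of `End⁰(A)` in `End_k(V(A))`:
  `C(A) = End_{End⁰(A) ⊗_ℚ k}(V(A))`."
* p0005 (p. 643): "**Remark 1.2.** Because `End⁰(A)` is a semisimple `ℚ`-algebra whose centre is separable over `ℚ`,
  `End⁰(A) ⊗_ℚ k` is a semisimple `k`-algebra. Therefore, the centralizer of `C(A)` in `End_k(V(A))` is
  `End⁰(A) ⊗_ℚ k`.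
  **Proposition 1.3.** The skew-symmetric `k`-bilinear forms `ψ : V(A) × V(A) → k(1)` such that
  `ψ ∘ (γ × 1) = ψ ∘ (1 × γ†)`, all `γ ∈ C(A)`, are exactly the `k`-linear combinations of forms `e_D` with `D` a
  divisor on `A`.
  *Proof.* Let `D₀` be an ample divisor on `A`, and let `†` be the involution it defines on `End_k(V(A))`. As we noted
  above, if `D` is a second divisor on `A`, then `e_D = e_{D₀} ∘ (α × 1)` for some `α ∈ End⁰(A)`. This implies that
  `e_D ∘ (γ × 1) = e_D ∘ (1 × γ†)` for all `γ ∈ C(A)`. Conversely, because `e_{D₀}` is non-degenerate, any `k`-bilinear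
  form `ψ : V(A) × V(A) → k(1)` can be written `ψ = e_{D₀} ∘ (β × 1)` for some `β ∈ End_k(V(A))`. If `ψ` is
  skew-symmetric, then `β = β†`, and (1.2) `ψ ∘ (γ × 1) = ψ ∘ (1 × γ†), ∀γ ∈ C(A) ⟹ βγ = γβ, ∀γ ∈ C(A) ⟹
  β ∈ End⁰(A) ⊗_ℚ k`. Therefore, any `ψ` as in the statement of the proposition is of the form `e_{D₀} ∘ (β × 1)` for
  some `β ∈ End⁰(A) ⊗_ℚ k` with `β = β†`. […] According to (Mumford 1970, p208), `e_{D₀} ∘ (βᵢ × 1)` is of the form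
  `e_{Dᵢ}` for a divisor `Dᵢ` on `A`, which completes the proof."
* p0006 (p. 644): "**Remark 1.4.** Let `A` be an abelian variety over `ℂ`, and let `V = V_B(A)`. To give `C(A)` with
  its action on `V` is the same as to give `End⁰(A)` with its action on `V`, and to give the involution `†` on `C(A)` is
  the same as to give the set `{e_D | D a divisor on A}`."; Remark 1.6: "`C′(A) ≅ C(A) ⊗_k k′`" for an extension of the
  coefficient field `k ⊂ k′`.

## Dictionary (the Betti theory `k = ℚ` of the tree's complex torus `X = E/Φ(ℤ^ι)`)

* `V_B(X) = H₁(X, ℚ) = Λ ⊗ ℚ = ℚ^ι` (the lattice basis `eᵢ`, `λᵢ = Φ(eᵢ)`); `End_k(V(X)) = M_ι(ℚ)`;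
  `End⁰(X) = End_ℚ(X) = endAlgRat Φ ⊆ M_ι(ℚ)` (rational representation; `ComplexTorusRosati.lean`).
* **`C(X) = Subalgebra.centralizer ℚ (endAlgRat Φ)`** — Milne's `C(A)` FOR `k = ℚ`, written with Mathlib's
  `Subalgebra.centralizer` (no new definition; this is the spelling already used by `ComplexTorusHodgeGroupCommutative`
  and `ComplexTorusMaximalPicardNumberCM`); its relation to the tree's `k = ℝ` algebra `endCentralizerAlg Φ` (Q155) is
  §1: `C(X)` = the rational points of `endCentralizerAlg Φ`, and `endCentralizerAlg Φ = C(X) ⊗_ℚ ℝ` (Remark 1.6's shape).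
* `e_D`, for `D ∈ NS_ℚ(X) = neronSeveriQ Φ` (the `(1,1)`-forms rational on the lattice = the `ℚ`-span of `NS(X)`,
  `span_neronSeveriGroup_eq`; over `ℂ` the class `cl(D) = c₁(D)` IS the alternating form `E_D = Im H_D`, Lange Prop.
  1.2.9 / Thm. 1.3.3, with `ℚ(1) = 2πiℚ` trivialised as usual), is the lattice form `(x, y) ↦ ᵗx G_D y` with the RATIONAL
  Gram matrix `G_D = ratGram Φ E_D`; "the `k`-linear combinations of forms `e_D`" = `{ratGram Φ η | η ∈ neronSeveriQ Φ}`
  (`neronSeveriQ Φ` is a `ℚ`-subspace and `ratGram` is `ℚ`-linear on it, `ratGram_add` / `ratGram_smul`).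
* A `k`-bilinear form `ψ` on `V(X)` is its matrix `Ψ ∈ M_ι(ℚ)`, `ψ(x, y) = ᵗx Ψ y = x ⬝ᵥ Ψ *ᵥ y`; skew-symmetric:
  `ᵗΨ = -Ψ`; `ψ ∘ (γ × 1) = ψ ∘ (1 × γ†)` reads `ψ(γx, y) = ψ(x, γ†y)` for all `x, y`, i.e. `ᵗγ Ψ = Ψ γ†`
  (`forall_dotProduct_mulVec_eq_iff_transpose_mul_eq` below).
* `†` for the ample `D₀` = a polarisation `E₀ = η₀` (`IsRiemannForm Φ η₀`) with rational invertible Gram matrix `G₀`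
  (`IsRiemannForm.exists_ratMatrix_latticeGram_isUnit`): `γ† = rosati G₀ γ = G₀⁻¹ ᵗγ G₀`, the adjoint for `e_{D₀}`
  (`dotProduct_mulVec_rosati`: `e_{D₀}(γx, y) = e_{D₀}(x, γ†y)`; Lange Prop. 2.4.2 (a)).

## Contents (theorems only)

* §1 `C(X)` over `ℚ` and over `ℝ`: `map_ratCast_mem_endCentralizerAlg_iff` (`C(X)` = rational points of
  `endCentralizerAlg Φ`), **`endCentralizerAlg_toSubmodule_eq_span`** (`endCentralizerAlg Φ = C(X) ⊗_ℚ ℝ`, i.e. the real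
  span of the realified `C(X)` — Remark 1.6's «`C′(A) ≅ C(A) ⊗_k k′`» for `ℚ ⊂ ℝ`, by rational descent),
  `IsRiemannForm.rosati_mem_centralizer_endAlgRat` (`C(X)` is `†`-stable: "`C(A)` is a `k`-algebra stable under the
  involution `†`", p. 643, now for `k = ℚ`).
* §2 **Remark 1.2 for `k = ℚ`**: **`centralizer_centralizer_endAlgRat_eq`** — the centraliser of `C(X)` in
  `End_ℚ(V(X)) = M_ι(ℚ)` is `End⁰(X)`; `mem_endAlgRat_iff_forall_centralizer`; `centralizer_inf_centralizer_centralizer_eq`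
  (the centre of `C(X)` is the centre of `End⁰(X)`, Milne's `C₀(A)` of p. 645). PROOF ROUTE (different from the printed
  one, which uses the semisimplicity of `End⁰(A)` and the double-centraliser theorem): the complex structure `J` lies in
  `endCentralizerAlg Φ = C(X) ⊗ ℝ` (`jMatrix_mem_span_centralizer_endAlgRat`), and a rational matrix commuting with `J`
  is an endomorphism (Lange Prop. 1.1.6 / proof of Prop. 7.2.5, `centralizer_le_endAlgRat_of_jMatrix_mem_span`); so
  `C(C(End⁰ X)) ⊆ End⁰(X)` holds for EVERY complex torus, polarised or not.
* §3 **Proposition 1.3 for `k = ℚ`**, Milne's proof line by line: `transpose_mul_ratGram_eq_of_mem_centralizer`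
  (every `e_D` is `†`-compatible: `e_D = e_{D₀} ∘ (φ × 1)` with `φ = φ_{D₀}⁻¹φ_D = nsToEnd ∈ End⁰(X)` commuting with
  `γ† ∈ C(X)`), `exists_mem_neronSeveriQ_ratGram_eq_of_forall_centralizer` (conversely: `β = G₀⁻¹Ψ`, "`β = β†`",
  "`βγ = γβ ∀γ ∈ C(A)`", "`β ∈ End⁰(A)`" by §2, "Mumford p208" = `exists_nsToEnd_eq`), the iff
  **`IsRiemannForm.forall_centralizer_transpose_mul_eq_iff`** and its bilinear reading
  **`IsRiemannForm.forall_centralizer_dotProduct_mulVec_eq_iff`** (`ψ(γx, y) = ψ(x, γ†y)`).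
* §4 the same statement read on `H²(X, ℚ) ⊂ H²(X, ℝ) = Alt²_ℝ(E; ℝ)` (Remark 1.4, the direction "`†` on `C(A)`
  determines the `e_D`"): **`IsRiemannForm.mem_neronSeveriQ_iff_forall_centralizer`** — a real `2`-form on `X` with
  rational Gram matrix on the lattice is of type `(1,1)` (equivalently: lies in `NS_ℚ(X)`) if and only if
  `ψ(ρ_r(γ)u, v) = ψ(u, ρ_r(γ†)v)` for all `γ ∈ C(X)`.
* §5 validation (Picard number one): for `End_ℚ(X) = ℚ` one has `C(X) = M_ι(ℚ)` (`centralizer_endAlgRat_eq_top_of_eq_bot`)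
  and the `†`-compatible skew forms are exactly `ℚ · E₀` (`IsRiemannForm.forall_transpose_mul_eq_iff_exists_eq_smul`) —
  Prop. 1.3 returns `NS_ℚ(X) = ℚ·[E₀]`, as it must.

NOT here: `k = ℝ` / `k = ℂ` versions of Remark 1.2 (they need the double-centraliser theorem for the semisimple
`End⁰(X) ⊗ k`; the Track-1 model layer `Literature/AlgebraicGeometry/Milne1999/` has `k = ℂ` on the carrier
`H¹(A(ℂ); ℂ)` via Deligne–Milne 6.20 — a different carrier, nothing of it is imported or restated); the ample-cone
sentence of Remark 1.4; `S(A)` (`ComplexTorusLefschetzGroupIsogenyFactors.lean`).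

## References

* [Milne1999LefschetzClasses] J. S. Milne, *Lefschetz classes on abelian varieties*, Duke Math. J. 96 (1999) 639–675,
  §1 pp. 642–644: `e_D`, `†`, `C(A)`, Remark 1.2, Proposition 1.3, Remarks 1.4 and 1.6.
* [MumfordAV1970] D. Mumford, *Abelian Varieties* (1970), §20–§21, Application III p. 208.
* [Lange2023AbelianVarietiesComplex] H. Lange, *Abelian Varieties over the Complex Numbers* (2023), §1.1.2 Prop. 1.1.6,
  §2.4.1 Prop. 2.4.2, §2.4.2 Prop. 2.4.12, §7.2.2 Prop. 7.2.5 (proof).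
-/

noncomputable section

open Module Matrix

namespace Literature.Geometry.Kaehler

namespace ComplexTorus

/-! ## §0 Plumbing: realification of rational matrices; bilinear forms vs. matrices -/

section Plumbing

variable {ι : Type*} [Fintype ι]

omit [Fintype ι] in
/-- The cast `M_ι(ℚ) → M_ι(ℝ)` is injective. [folklore] -/
private theorem map_ratCast_injective' :
    Function.Injective (fun A : Matrix ι ι ℚ ↦ A.map (Rat.cast : ℚ → ℝ)) :=
  fun _ _ h ↦ Matrix.map_injective Rat.cast_injective h

/-- `(A B)_ℝ = A_ℝ B_ℝ`. [folklore] -/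
private theorem map_ratCast_mul' (A B : Matrix ι ι ℚ) :
    (A * B).map (Rat.cast : ℚ → ℝ) = A.map (Rat.cast : ℚ → ℝ) * B.map (Rat.cast : ℚ → ℝ) :=
  Matrix.map_mul (f := Rat.castHom ℝ)

omit [Fintype ι] in
/-- `(ᵗA)_ℝ = ᵗ(A_ℝ)`. [folklore] -/
private theorem map_ratCast_transpose' (A : Matrix ι ι ℚ) :
    Aᵀ.map (Rat.cast : ℚ → ℝ) = (A.map (Rat.cast : ℚ → ℝ))ᵀ :=
  Matrix.transpose_map.symm

/-- `ψ(Ax, y) = ᵗx (ᵗA Ψ) y` for `ψ(x, y) = ᵗx Ψ y`. [folklore] -/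
private theorem dotProduct_mulVec_mulVec_eq {R : Type*} [CommRing R] (A Ψ : Matrix ι ι R) (x y : ι → R) :
    (A *ᵥ x) ⬝ᵥ Ψ *ᵥ y = x ⬝ᵥ (Aᵀ * Ψ) *ᵥ y := by
  rw [← Matrix.mulVec_mulVec, Matrix.dotProduct_mulVec x Aᵀ, Matrix.vecMul_transpose]

variable [DecidableEq ι]

/-- A bilinear form `(x, y) ↦ ᵗx M y` determines its matrix: `ᵗx M y = ᵗx N y` for all `x, y` iff `M = N`
(Milne's forms `ψ : V(A) × V(A) → k` versus their matrices). [folklore] -/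
private theorem forall_dotProduct_mulVec_iff {R : Type*} [CommRing R] {M N : Matrix ι ι R} :
    (∀ x y : ι → R, x ⬝ᵥ M *ᵥ y = x ⬝ᵥ N *ᵥ y) ↔ M = N := by
  refine ⟨fun h ↦ Matrix.toBilin'.injective (LinearMap.ext₂ fun x y ↦ ?_), fun h _ _ ↦ by rw [h]⟩
  rw [Matrix.toBilin'_apply', Matrix.toBilin'_apply', h]

/-- **`ψ ∘ (A × 1) = ψ ∘ (1 × B)` iff `ᵗA Ψ = Ψ B`**, for the bilinear form `ψ(x, y) = ᵗx Ψ y` on `k^ι` (the matrix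
reading of Milne's compatibility condition "`ψ ∘ (γ × 1) = ψ ∘ (1 × γ†)`" and of the adjoint
"`e_D(βx, y) = e_D(x, β†y)`"). [cite: Milne1999LefschetzClasses, §1 (p. 642, the adjoint `β†`; p. 643, Prop. 1.3)] -/
theorem forall_dotProduct_mulVec_eq_iff_transpose_mul_eq {R : Type*} [CommRing R] (A B Ψ : Matrix ι ι R) :
    (∀ x y : ι → R, (A *ᵥ x) ⬝ᵥ Ψ *ᵥ y = x ⬝ᵥ Ψ *ᵥ (B *ᵥ y)) ↔ Aᵀ * Ψ = Ψ * B := by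
  simp_rw [dotProduct_mulVec_mulVec_eq, Matrix.mulVec_mulVec]
  exact forall_dotProduct_mulVec_iff

end Plumbing

/-! ## §1 Milne's `C(A)` for `k = ℚ` and for `k = ℝ` -/

section CentralizerRat

variable {ι : Type*} [Fintype ι] [DecidableEq ι] {E : Type*} [NormedAddCommGroup E] [NormedSpace ℂ E]
  (Φ : (ι → ℝ) ≃L[ℝ] E)

/-- **`C(X)` for `k = ℚ` is the set of rational points of `C(X)` for `k = ℝ`**: a rational matrix `γ` commutes with
`End_ℚ(X)` iff its realification lies in `endCentralizerAlg Φ` (Milne: `C(A) = End_{End⁰(A) ⊗_ℚ k}(V(A))`, for the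
two coefficient fields `k = ℚ ⊂ ℝ`). [cite: Milne1999LefschetzClasses, §1 (p. 642, the algebra `C(A)`) and Remark 1.6] -/
theorem map_ratCast_mem_endCentralizerAlg_iff {γ : Matrix ι ι ℚ} :
    γ.map (Rat.cast : ℚ → ℝ) ∈ endCentralizerAlg Φ ↔
      γ ∈ Subalgebra.centralizer ℚ (endAlgRat Φ : Set (Matrix ι ι ℚ)) := by
  rw [mem_endCentralizerAlg_iff, Subalgebra.mem_centralizer_iff]
  refine forall₂_congr fun A _ ↦ ?_
  rw [← map_ratCast_mul', ← map_ratCast_mul', map_ratCast_injective'.eq_iff, eq_comm]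

/-- **`C(X) ⊗_ℚ ℝ = C_ℝ(X)`** — Milne's Remark 1.6 «`C′(A) ≅ C(A) ⊗_k k′`» for `k = ℚ ⊂ k′ = ℝ` at torus level: the
`ℝ`-algebra `endCentralizerAlg Φ` (the centraliser of `End_ℚ(X)` in `M_ι(ℝ)`) is the real span of the (realified)
rational centraliser `C(X)`. `⊆` is rational descent (`mem_span_map_ratCast_centralizer_of_forall_commute`: a real
matrix commuting with rational matrices is a real combination of rational matrices commuting with them).
[cite: Milne1999LefschetzClasses, §1 Remark 1.6 (p. 644)] -/
theorem endCentralizerAlg_toSubmodule_eq_span :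
    Subalgebra.toSubmodule (endCentralizerAlg Φ) =
      Submodule.span ℝ ((fun A : Matrix ι ι ℚ ↦ A.map (Rat.cast : ℚ → ℝ)) ''
        (Subalgebra.centralizer ℚ (endAlgRat Φ : Set (Matrix ι ι ℚ)) : Set (Matrix ι ι ℚ))) := by
  apply le_antisymm
  · intro M hM
    rw [Subalgebra.mem_toSubmodule] at hM
    exact mem_span_map_ratCast_centralizer_of_forall_commute _ fun B hB ↦
      ((mem_endCentralizerAlg_iff Φ).1 hM B hB).symm
  · rw [Submodule.span_le]
    rintro _ ⟨γ, hγ, rfl⟩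
    exact (map_ratCast_mem_endCentralizerAlg_iff Φ).2 hγ

/-- Every element of `C_ℝ(X)` is a real combination of elements of `C(X)`. [cite: Milne1999LefschetzClasses, §1 Remark 1.6 (p. 644)] -/
theorem mem_span_centralizer_of_mem_endCentralizerAlg {M : Matrix ι ι ℝ} (hM : M ∈ endCentralizerAlg Φ) :
    M ∈ Submodule.span ℝ ((fun A : Matrix ι ι ℚ ↦ A.map (Rat.cast : ℚ → ℝ)) ''
      (Subalgebra.centralizer ℚ (endAlgRat Φ : Set (Matrix ι ι ℚ)) : Set (Matrix ι ι ℚ))) := by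
  rw [← endCentralizerAlg_toSubmodule_eq_span Φ, Subalgebra.mem_toSubmodule]
  exact hM

/-- `End⁰(X) ⊆ C(C(X))`: an endomorphism commutes with everything that commutes with all endomorphisms (the trivial
half of Remark 1.2). [cite: Milne1999LefschetzClasses, §1 Remark 1.2 (p. 643)] -/
theorem le_centralizer_centralizer_endAlgRat :
    endAlgRat Φ ≤ Subalgebra.centralizer ℚ
      (Subalgebra.centralizer ℚ (endAlgRat Φ : Set (Matrix ι ι ℚ)) : Set (Matrix ι ι ℚ)) := by
  intro A hA
  rw [Subalgebra.mem_centralizer_iff]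
  intro γ hγ
  exact ((Subalgebra.mem_centralizer_iff ℚ).1 hγ A hA).symm

variable {Φ}

/-- **"`C(A)` is a `k`-algebra stable under the involution `†`", for `k = ℚ`**: for a polarisation `E₀` with rational
Gram matrix `G₀`, `γ ∈ C(X) ⇒ γ† = G₀⁻¹ ᵗγ G₀ ∈ C(X)` (`End_ℚ(X)` is `†`-stable, Lange Lemma 2.4.1, and `†` is an
anti-involution). [cite: Milne1999LefschetzClasses, §1 (p. 643, "`C(A)` is a `k`-algebra stable under the involution `†`")]
[cite: Lange2023AbelianVarietiesComplex, §2.4.1 Lemma 2.4.1] -/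
theorem IsRiemannForm.rosati_mem_centralizer_endAlgRat {η₀ : E [⋀^Fin 2]→L[ℝ] ℝ} (hη₀ : IsRiemannForm Φ η₀)
    {G₀ : Matrix ι ι ℚ} (hG₀ : G₀.map (Rat.cast : ℚ → ℝ) = latticeGram Φ η₀) {γ : Matrix ι ι ℚ}
    (hγ : γ ∈ Subalgebra.centralizer ℚ (endAlgRat Φ : Set (Matrix ι ι ℚ))) :
    rosati G₀ γ ∈ Subalgebra.centralizer ℚ (endAlgRat Φ : Set (Matrix ι ι ℚ)) := by
  have hdet : IsUnit G₀.det := isUnit_det_of_map_ratCast hG₀ hη₀.isUnit_det_latticeGram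
  have hG₀t : G₀ᵀ = -G₀ := transpose_eq_neg_of_map_ratCast Φ hG₀
  rw [Subalgebra.mem_centralizer_iff] at hγ ⊢
  intro A hA
  -- `A† ∈ End_ℚ(X)` commutes with `γ`; apply the anti-involution `†`
  have hc := hγ _ (rosati_mem_endAlgRat Φ hη₀.1 hη₀.2.2 hG₀ hA)
  have h := congrArg (rosati G₀) hc
  rw [rosati_mul hdet, rosati_mul hdet, rosati_rosati hdet hG₀t] at h
  exact h.symm

end CentralizerRat

/-! ## §2 Remark 1.2 for `k = ℚ`: the centraliser of `C(X)` in `M_ι(ℚ)` is `End⁰(X)` -/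

section Remark12

variable {ι : Type*} [Fintype ι] [DecidableEq ι] {E : Type*} [NormedAddCommGroup E] [NormedSpace ℂ E]
  (Φ : (ι → ℝ) ≃L[ℝ] E)

/-- **Milne 1999, Remark 1.2, for the Betti theory (`k = ℚ`), at torus level: "the centralizer of `C(A)` in
`End_k(V(A))` is `End⁰(A) ⊗_ℚ k`"** — for the complex torus `X = E/Φ(ℤ^ι)`, the double centraliser of
`End_ℚ(X) ⊆ M_ι(ℚ) = End_ℚ(H₁(X, ℚ))` is `End_ℚ(X)` itself. Milne derives this from the semisimplicity of `End⁰(A)`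
(double-centraliser theorem); here it holds for every complex torus because `J ∈ C(X) ⊗ ℝ`
(`jMatrix_mem_span_centralizer_endAlgRat`) and a rational matrix commuting with `C(X)`, hence with `J`, is an
endomorphism (`centralizer_le_endAlgRat_of_jMatrix_mem_span`, Lange Prop. 1.1.6 / proof of Prop. 7.2.5).
[cite: Milne1999LefschetzClasses, §1 Remark 1.2 (p. 643)] [cite: Lange2023AbelianVarietiesComplex, §7.2.2 Prop. 7.2.5 (proof)] -/
theorem centralizer_centralizer_endAlgRat_eq :
    Subalgebra.centralizer ℚ
        (Subalgebra.centralizer ℚ (endAlgRat Φ : Set (Matrix ι ι ℚ)) : Set (Matrix ι ι ℚ)) = endAlgRat Φ :=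
  le_antisymm (centralizer_le_endAlgRat_of_jMatrix_mem_span Φ (jMatrix_mem_span_centralizer_endAlgRat Φ))
    (le_centralizer_centralizer_endAlgRat Φ)

/-- Remark 1.2 (`k = ℚ`) on elements: a rational matrix is (the rational representation of) an element of `End_ℚ(X)`
iff it commutes with every element of `C(X)`. [cite: Milne1999LefschetzClasses, §1 Remark 1.2 (p. 643)] -/
theorem mem_endAlgRat_iff_forall_centralizer {β : Matrix ι ι ℚ} :
    β ∈ endAlgRat Φ ↔
      ∀ γ ∈ Subalgebra.centralizer ℚ (endAlgRat Φ : Set (Matrix ι ι ℚ)), γ * β = β * γ :=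
  ⟨fun hβ γ hγ ↦ (Subalgebra.mem_centralizer_iff ℚ).1 (le_centralizer_centralizer_endAlgRat Φ hβ) γ hγ,
    fun h ↦ (centralizer_centralizer_endAlgRat_eq Φ).le ((Subalgebra.mem_centralizer_iff ℚ).2 h)⟩

/-- **The centre of `C(X)` is the centre of `End⁰(X)`** (`= End⁰(X) ∩ C(X)`; Milne's `C₀(A)`, p. 645, in the Betti
theory): `C(X) ∩ C(C(X)) = End⁰(X) ∩ C(X)`, by Remark 1.2. [cite: Milne1999LefschetzClasses, §1 Remark 1.2 (p. 643) and p. 645 (`C₀(A)`)] -/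
theorem centralizer_inf_centralizer_centralizer_eq :
    Subalgebra.centralizer ℚ (endAlgRat Φ : Set (Matrix ι ι ℚ)) ⊓
        Subalgebra.centralizer ℚ
          (Subalgebra.centralizer ℚ (endAlgRat Φ : Set (Matrix ι ι ℚ)) : Set (Matrix ι ι ℚ)) =
      endAlgRat Φ ⊓ Subalgebra.centralizer ℚ (endAlgRat Φ : Set (Matrix ι ι ℚ)) := by
  rw [centralizer_centralizer_endAlgRat_eq, inf_comm]

end Remark12

/-! ## §3 Proposition 1.3 for `k = ℚ`: the `†`-compatible skew forms are the `ℚ`-span of the `e_D` -/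

section Prop13

variable {ι : Type*} [Fintype ι] [DecidableEq ι] {E : Type*} [NormedAddCommGroup E] [NormedSpace ℂ E]
  {Φ : (ι → ℝ) ≃L[ℝ] E} {η₀ : E [⋀^Fin 2]→L[ℝ] ℝ} {G₀ : Matrix ι ι ℚ}

/-- **Prop. 1.3, the easy direction: every `e_D` is `†`-compatible with `C(A)`.** For `D ∈ NS_ℚ(X)` with rational Gram
matrix `G_D` and every `γ ∈ C(X)`: `ᵗγ G_D = G_D γ†`, i.e. `e_D(γx, y) = e_D(x, γ†y)` ("if `D` is a second divisor on
`A`, then `e_D = e_{D₀} ∘ (α × 1)` for some `α ∈ End⁰(A)`. This implies that `e_D ∘ (γ × 1) = e_D ∘ (1 × γ†)` for all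
`γ ∈ C(A)`": here `α = φ_{D₀}⁻¹ φ_D = nsToEnd`, `G_D = G₀ α`, and `γ† ∈ C(X)` commutes with `α`).
[cite: Milne1999LefschetzClasses, §1 Prop. 1.3 (p. 643, proof, first half)] -/
theorem transpose_mul_ratGram_eq_of_mem_centralizer (hη₀ : IsRiemannForm Φ η₀)
    (hG₀ : G₀.map (Rat.cast : ℚ → ℝ) = latticeGram Φ η₀) {η : E [⋀^Fin 2]→L[ℝ] ℝ} (hη : η ∈ neronSeveriQ Φ)
    {γ : Matrix ι ι ℚ} (hγ : γ ∈ Subalgebra.centralizer ℚ (endAlgRat Φ : Set (Matrix ι ι ℚ))) :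
    γᵀ * ratGram Φ η = ratGram Φ η * rosati G₀ γ := by
  have hdet : IsUnit G₀.det := isUnit_det_of_map_ratCast hG₀ hη₀.isUnit_det_latticeGram
  -- `e_D = e_{D₀} ∘ (φ × 1)`: `G_D = G₀ φ` with `φ = φ_{D₀}⁻¹ φ_D ∈ End_ℚ(X)`
  set φ : Matrix ι ι ℚ := nsToEnd Φ G₀ ⟨η, hη⟩ with hφdef
  have hφ : φ ∈ endAlgRat Φ := (nsToEnd_mem_symmEndRat hη₀.1 hG₀ hdet ⟨η, hη⟩).1
  have hGφ : G₀ * φ = ratGram Φ η := (transpose_nsToEnd_mul hG₀ hdet ⟨η, hη⟩).2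
  -- `γ† ∈ C(X)` commutes with `φ`
  have hcomm : φ * rosati G₀ γ = rosati G₀ γ * φ :=
    (Subalgebra.mem_centralizer_iff ℚ).1 (hη₀.rosati_mem_centralizer_endAlgRat hG₀ hγ) φ hφ
  rw [← hGφ]
  calc γᵀ * (G₀ * φ) = γᵀ * G₀ * φ := (Matrix.mul_assoc _ _ _).symm
    _ = G₀ * rosati G₀ γ * φ := by rw [mul_rosati hdet]
    _ = G₀ * (φ * rosati G₀ γ) := by rw [Matrix.mul_assoc, hcomm]
    _ = G₀ * φ * rosati G₀ γ := (Matrix.mul_assoc _ _ _).symm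

/-- **Prop. 1.3, the converse: a skew form `†`-compatible with `C(A)` is a combination of the `e_D`.** For a rational
skew-symmetric matrix `Ψ` (the form `ψ(x, y) = ᵗx Ψ y` on `V(X) = ℚ^ι`) with `ᵗγ Ψ = Ψ γ†` for all `γ ∈ C(X)` there is
`D ∈ NS_ℚ(X)` with `G_D = Ψ`. Milne's proof: "`ψ = e_{D₀} ∘ (β × 1)`" (`β = G₀⁻¹Ψ`); "If `ψ` is skew-symmetric, then
`β = β†`"; "(1.2) `⟹ βγ = γβ, ∀γ ∈ C(A) ⟹ β ∈ End⁰(A) ⊗_ℚ k`" (Remark 1.2, `k = ℚ`: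
`centralizer_centralizer_endAlgRat_eq`); "According to (Mumford 1970, p208), `e_{D₀} ∘ (βᵢ × 1)` is of the form
`e_{Dᵢ}`" (the tree's `exists_nsToEnd_eq`, Lange Prop. 2.4.12).
[cite: Milne1999LefschetzClasses, §1 Prop. 1.3 (p. 643, proof, second half)] [cite: MumfordAV1970, §21 Application III (p. 208)] -/
theorem exists_mem_neronSeveriQ_ratGram_eq_of_forall_centralizer (hη₀ : IsRiemannForm Φ η₀)
    (hG₀ : G₀.map (Rat.cast : ℚ → ℝ) = latticeGram Φ η₀) {Ψ : Matrix ι ι ℚ} (hΨ : Ψᵀ = -Ψ)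
    (h : ∀ γ ∈ Subalgebra.centralizer ℚ (endAlgRat Φ : Set (Matrix ι ι ℚ)), γᵀ * Ψ = Ψ * rosati G₀ γ) :
    ∃ η ∈ neronSeveriQ Φ, ratGram Φ η = Ψ := by
  have hdet : IsUnit G₀.det := isUnit_det_of_map_ratCast hG₀ hη₀.isUnit_det_latticeGram
  have hG₀t : G₀ᵀ = -G₀ := transpose_eq_neg_of_map_ratCast Φ hG₀
  have hu : IsUnit G₀ := (Matrix.isUnit_iff_isUnit_det G₀).2 hdet
  -- "`ψ = e_{D₀} ∘ (β × 1)` for some `β ∈ End_k(V(A))`": `β = G₀⁻¹ Ψ`, `G₀ β = Ψ`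
  set β : Matrix ι ι ℚ := G₀⁻¹ * Ψ with hβ
  have hG₀β : G₀ * β = Ψ := by rw [hβ, Matrix.mul_nonsing_inv_cancel_left _ _ hdet]
  -- "If `ψ` is skew-symmetric, then `β = β†`": `ᵗβ G₀ = -ᵗ(G₀ β) = -ᵗΨ = Ψ = G₀ β`
  have hβt : βᵀ * G₀ = Ψ := by
    have h1 : (G₀ * β)ᵀ = -(βᵀ * G₀) := by rw [Matrix.transpose_mul, hG₀t, Matrix.mul_neg]
    rw [hG₀β, hΨ, neg_inj] at h1
    exact h1.symm
  have hβsymm : rosati G₀ β = β := by rw [rosati_eq_iff hdet, hβt, hG₀β]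
  -- "(1.2) ⟹ `βγ = γβ` for all `γ ∈ C(A)`": test the hypothesis on `γ = δ†` (`δ†† = δ`, `ᵗ(δ†) G₀ = G₀ δ`)
  have hβcomm : ∀ δ ∈ Subalgebra.centralizer ℚ (endAlgRat Φ : Set (Matrix ι ι ℚ)), δ * β = β * δ := by
    intro δ hδ
    have hγ := hη₀.rosati_mem_centralizer_endAlgRat hG₀ hδ
    have h2 : (rosati G₀ δ)ᵀ * G₀ = G₀ * δ := by rw [← mul_rosati hdet, rosati_rosati hdet hG₀t]
    have h3 : G₀ * (δ * β) = G₀ * (β * δ) :=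
      calc G₀ * (δ * β) = (rosati G₀ δ)ᵀ * G₀ * β := by rw [h2, Matrix.mul_assoc]
        _ = (rosati G₀ δ)ᵀ * Ψ := by rw [Matrix.mul_assoc, hG₀β]
        _ = Ψ * rosati G₀ (rosati G₀ δ) := h _ hγ
        _ = G₀ * (β * δ) := by rw [rosati_rosati hdet hG₀t, ← hG₀β, Matrix.mul_assoc]
    exact hu.mul_right_injective h3
  -- "⟹ `β ∈ End⁰(A) ⊗_ℚ k`" (Remark 1.2, `k = ℚ`)
  have hβE : β ∈ endAlgRat Φ :=
    (centralizer_centralizer_endAlgRat_eq Φ).le ((Subalgebra.mem_centralizer_iff ℚ).2 hβcomm)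
  -- "According to (Mumford 1970, p208), `e_{D₀} ∘ (β × 1)` is of the form `e_D`"
  obtain ⟨η, hη⟩ := exists_nsToEnd_eq hη₀.1 hG₀ hdet (A := β) ⟨hβE, hβsymm⟩
  refine ⟨η, η.2, ?_⟩
  have h4 := congrArg (fun M ↦ G₀ * M) hη
  simp only [nsToEnd_apply, Matrix.mul_nonsing_inv_cancel_left _ _ hdet] at h4
  rw [h4, hG₀β]

/-- **Milne 1999, Proposition 1.3, for the Betti theory (`k = ℚ`), at torus level.** Let `X = E/Φ(ℤ^ι)` be a
polarised complex torus (abelian variety), `E₀` a polarisation with rational Gram matrix `G₀` on the lattice basis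
(the ample `D₀`; `†` = `rosati G₀`, the adjoint for `e_{D₀}`), `C(X)` the centraliser of `End_ℚ(X)` in
`M_ι(ℚ) = End_ℚ(H₁(X, ℚ))`. **A skew-symmetric `ℚ`-bilinear form `ψ(x, y) = ᵗx Ψ y` on `V(X) = H₁(X, ℚ)` satisfies
`ψ ∘ (γ × 1) = ψ ∘ (1 × γ†)` for all `γ ∈ C(X)` if and only if it is a `ℚ`-linear combination of the forms `e_D`, `D`
a divisor — i.e. iff `Ψ` is the Gram matrix of an element of `NS_ℚ(X) = NS(X) ⊗ ℚ`** ("The skew-symmetric `k`-bilinear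
forms `ψ : V(A) × V(A) → k(1)` such that `ψ ∘ (γ × 1) = ψ ∘ (1 × γ†)`, all `γ ∈ C(A)`, are exactly the `k`-linear
combinations of forms `e_D` with `D` a divisor on `A`").
[cite: Milne1999LefschetzClasses, §1 Prop. 1.3 (p. 643)] -/
theorem IsRiemannForm.forall_centralizer_transpose_mul_eq_iff (hη₀ : IsRiemannForm Φ η₀)
    (hG₀ : G₀.map (Rat.cast : ℚ → ℝ) = latticeGram Φ η₀) {Ψ : Matrix ι ι ℚ} (hΨ : Ψᵀ = -Ψ) :
    (∀ γ ∈ Subalgebra.centralizer ℚ (endAlgRat Φ : Set (Matrix ι ι ℚ)), γᵀ * Ψ = Ψ * rosati G₀ γ) ↔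
      ∃ η ∈ neronSeveriQ Φ, ratGram Φ η = Ψ := by
  refine ⟨exists_mem_neronSeveriQ_ratGram_eq_of_forall_centralizer hη₀ hG₀ hΨ, ?_⟩
  rintro ⟨η, hη, rfl⟩ γ hγ
  exact transpose_mul_ratGram_eq_of_mem_centralizer hη₀ hG₀ hη hγ

/-- **Proposition 1.3 (`k = ℚ`) with the compatibility written on vectors**, `ψ(γx, y) = ψ(x, γ†y)` for all
`x, y ∈ V(X) = ℚ^ι` (Milne's "`ψ ∘ (γ × 1) = ψ ∘ (1 × γ†)`" literally), `ψ(x, y) = ᵗx Ψ y` skew-symmetric: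
this holds for all `γ ∈ C(X)` iff `ψ` is a `ℚ`-combination of the `e_D`. [cite: Milne1999LefschetzClasses, §1 Prop. 1.3 (p. 643)] -/
theorem IsRiemannForm.forall_centralizer_dotProduct_mulVec_eq_iff (hη₀ : IsRiemannForm Φ η₀)
    (hG₀ : G₀.map (Rat.cast : ℚ → ℝ) = latticeGram Φ η₀) {Ψ : Matrix ι ι ℚ} (hΨ : Ψᵀ = -Ψ) :
    (∀ γ ∈ Subalgebra.centralizer ℚ (endAlgRat Φ : Set (Matrix ι ι ℚ)),
        ∀ x y : ι → ℚ, (γ *ᵥ x) ⬝ᵥ Ψ *ᵥ y = x ⬝ᵥ Ψ *ᵥ (rosati G₀ γ *ᵥ y)) ↔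
      ∃ η ∈ neronSeveriQ Φ, ratGram Φ η = Ψ := by
  simp_rw [forall_dotProduct_mulVec_eq_iff_transpose_mul_eq]
  exact hη₀.forall_centralizer_transpose_mul_eq_iff hG₀ hΨ

/-- Proposition 1.3 for an ABELIAN VARIETY (some polarisation exists; its rational Gram matrix is produced here):
the `†`-compatible skew forms, for the `†` of any polarisation `E₀`, are the combinations of the `e_D`.
[cite: Milne1999LefschetzClasses, §1 Prop. 1.3 (p. 643)] -/
theorem IsRiemannForm.exists_ratGram_forall_centralizer_iff (hη₀ : IsRiemannForm Φ η₀) :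
    ∃ G₀ : Matrix ι ι ℚ, G₀.map (Rat.cast : ℚ → ℝ) = latticeGram Φ η₀ ∧ IsUnit G₀.det ∧
      ∀ Ψ : Matrix ι ι ℚ, Ψᵀ = -Ψ →
        ((∀ γ ∈ Subalgebra.centralizer ℚ (endAlgRat Φ : Set (Matrix ι ι ℚ)), γᵀ * Ψ = Ψ * rosati G₀ γ) ↔
          ∃ η ∈ neronSeveriQ Φ, ratGram Φ η = Ψ) := by
  obtain ⟨G₀, hG₀, hdet⟩ := hη₀.exists_ratMatrix_latticeGram_isUnit
  exact ⟨G₀, hG₀, hdet, fun Ψ hΨ ↦ hη₀.forall_centralizer_transpose_mul_eq_iff hG₀ hΨ⟩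

end Prop13

/-! ## §4 The same statement on `H²(X, ℚ) ⊂ Alt²_ℝ(E; ℝ)`: type `(1,1)` ⟺ `†`-compatibility with `C(X)` -/

section Forms

variable {ι : Type*} [Fintype ι] [DecidableEq ι] {E : Type*} [NormedAddCommGroup E] [NormedSpace ℂ E]
  {Φ : (ι → ℝ) ≃L[ℝ] E} {η₀ : E [⋀^Fin 2]→L[ℝ] ℝ} {G₀ : Matrix ι ι ℚ}

/-- The identity `ψ(Φ(Ax), Φy) = ψ(Φx, Φ(By))` on `Λ ⊗ ℝ` for all `x, y` is the matrix identity `ᵗA G_ψ = G_ψ B` for the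
Gram matrix `G_ψ` of `ψ` on the lattice basis. [cite: Lange2023AbelianVarietiesComplex, §1.5.1 (the matrix of `E`)] -/
theorem forall_twoForm_mulVec_eq_iff {ψ : E [⋀^Fin 2]→L[ℝ] ℝ} (A B : Matrix ι ι ℝ) :
    (∀ x y : ι → ℝ, ψ ![Φ (A *ᵥ x), Φ y] = ψ ![Φ x, Φ (B *ᵥ y)]) ↔
      Aᵀ * latticeGram Φ ψ = latticeGram Φ ψ * B := by
  simp_rw [← dotProduct_latticeGram_mulVec]
  exact forall_dotProduct_mulVec_eq_iff_transpose_mul_eq A B _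

/-- The rational Gram matrix of a form in `NS_ℚ(X)` is the unique rational matrix realifying to its Gram matrix.
[cite: Lange2023AbelianVarietiesComplex, §1.5.1] -/
theorem ratGram_eq_of_map_eq_latticeGram {ψ : E [⋀^Fin 2]→L[ℝ] ℝ} (hψ : ψ ∈ neronSeveriQ Φ) {Ψ : Matrix ι ι ℚ}
    (hΨ : Ψ.map (Rat.cast : ℚ → ℝ) = latticeGram Φ ψ) : ratGram Φ ψ = Ψ :=
  map_ratCast_injective' (by dsimp only; rw [map_ratGram Φ hψ, hΨ])

/-- **Milne 1999, Prop. 1.3 / Remark 1.4 read on `H²(X, ℚ)`** ("to give the involution `†` on `C(A)` is the same as to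
give the set `{e_D | D a divisor on A}`" — the direction `†|_{C(A)} ↦ {e_D}`): for a polarised complex torus
`X = E/Φ(ℤ^ι)` (polarisation `E₀`, rational Gram matrix `G₀`, `†` = `rosati G₀`) and a real `2`-form `ψ` on `X` with
RATIONAL Gram matrix `Ψ` on the lattice basis (a class in `H²(X, ℚ)`), **`ψ` lies in `NS_ℚ(X)` — equivalently, `ψ` is of
type `(1,1)` — if and only if `ψ(ρ_r(γ)u, v) = ψ(u, ρ_r(γ†)v)` on `Λ ⊗ ℝ` for every `γ ∈ C(X)`** (the centraliser of
`End_ℚ(X)` in `M_ι(ℚ)`). [cite: Milne1999LefschetzClasses, §1 Prop. 1.3 and Remark 1.4 (pp. 643–644)] -/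
theorem IsRiemannForm.mem_neronSeveriQ_iff_forall_centralizer (hη₀ : IsRiemannForm Φ η₀)
    (hG₀ : G₀.map (Rat.cast : ℚ → ℝ) = latticeGram Φ η₀) {ψ : E [⋀^Fin 2]→L[ℝ] ℝ} {Ψ : Matrix ι ι ℚ}
    (hΨ : Ψ.map (Rat.cast : ℚ → ℝ) = latticeGram Φ ψ) :
    ψ ∈ neronSeveriQ Φ ↔
      ∀ γ ∈ Subalgebra.centralizer ℚ (endAlgRat Φ : Set (Matrix ι ι ℚ)), ∀ x y : ι → ℝ,
        ψ ![Φ (γ.map (Rat.cast : ℚ → ℝ) *ᵥ x), Φ y] =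
          ψ ![Φ x, Φ ((rosati G₀ γ).map (Rat.cast : ℚ → ℝ) *ᵥ y)] := by
  -- the form identity for `γ` is the rational matrix identity `ᵗγ Ψ = Ψ γ†`
  have key : ∀ γ : Matrix ι ι ℚ,
      (∀ x y : ι → ℝ, ψ ![Φ (γ.map (Rat.cast : ℚ → ℝ) *ᵥ x), Φ y] =
          ψ ![Φ x, Φ ((rosati G₀ γ).map (Rat.cast : ℚ → ℝ) *ᵥ y)]) ↔ γᵀ * Ψ = Ψ * rosati G₀ γ := by
    intro γ
    rw [forall_twoForm_mulVec_eq_iff, ← hΨ, ← map_ratCast_transpose', ← map_ratCast_mul', ← map_ratCast_mul',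
      map_ratCast_injective'.eq_iff]
  simp_rw [key]
  have hΨt : Ψᵀ = -Ψ := transpose_eq_neg_of_map_ratCast Φ hΨ
  rw [hη₀.forall_centralizer_transpose_mul_eq_iff hG₀ hΨt]
  constructor
  · exact fun hψ ↦ ⟨ψ, hψ, ratGram_eq_of_map_eq_latticeGram hψ hΨ⟩
  · rintro ⟨η, hη, hηΨ⟩
    have hηψ : η = ψ := eq_of_latticeGram_eq Φ (by rw [← map_ratGram Φ hη, hηΨ, hΨ])
    exact hηψ ▸ hη

/-- In particular (`⇒`, the form-level reading of the first half of Prop. 1.3): every `E ∈ NS_ℚ(X)` — every `e_D` —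
satisfies `E(ρ_r(γ)u, v) = E(u, ρ_r(γ†)v)` for all `γ ∈ C(X)`, for the `†` of any polarisation.
[cite: Milne1999LefschetzClasses, §1 Prop. 1.3 (p. 643)] -/
theorem IsRiemannForm.twoForm_mulVec_eq_of_mem_neronSeveriQ (hη₀ : IsRiemannForm Φ η₀)
    (hG₀ : G₀.map (Rat.cast : ℚ → ℝ) = latticeGram Φ η₀) {ψ : E [⋀^Fin 2]→L[ℝ] ℝ} (hψ : ψ ∈ neronSeveriQ Φ)
    {γ : Matrix ι ι ℚ} (hγ : γ ∈ Subalgebra.centralizer ℚ (endAlgRat Φ : Set (Matrix ι ι ℚ))) (x y : ι → ℝ) :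
    ψ ![Φ (γ.map (Rat.cast : ℚ → ℝ) *ᵥ x), Φ y] = ψ ![Φ x, Φ ((rosati G₀ γ).map (Rat.cast : ℚ → ℝ) *ᵥ y)] :=
  (hη₀.mem_neronSeveriQ_iff_forall_centralizer hG₀ (map_ratGram Φ hψ)).1 hψ γ hγ x y

end Forms

/-! ## §5 Validation: Picard number one (`End_ℚ(X) = ℚ`) -/

section PicardOne

variable {ι : Type*} [Fintype ι] [DecidableEq ι] {E : Type*} [NormedAddCommGroup E] [NormedSpace ℂ E]
  {Φ : (ι → ℝ) ≃L[ℝ] E} {η₀ : E [⋀^Fin 2]→L[ℝ] ℝ} {G₀ : Matrix ι ι ℚ}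

variable (Φ) in
/-- For `End_ℚ(X) = ℚ` (no endomorphisms beyond the homotheties), `C(X)` is all of `End_ℚ(V(X)) = M_ι(ℚ)`.
[cite: Milne1999LefschetzClasses, §1 (p. 642, the algebra `C(A)`)] -/
theorem centralizer_endAlgRat_eq_top_of_eq_bot (h : endAlgRat Φ = ⊥) :
    Subalgebra.centralizer ℚ (endAlgRat Φ : Set (Matrix ι ι ℚ)) = ⊤ := by
  rw [h, Subalgebra.centralizer_eq_top_iff_subset]
  intro A hA
  obtain ⟨c, rfl⟩ := Algebra.mem_bot.1 hA
  exact Subalgebra.mem_center_iff.2 fun B ↦ (Algebra.commutes c B).symm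

/-- **Validation of Prop. 1.3 (Picard number one).** For a polarised complex torus with `End_ℚ(X) = ℚ` (so that
`C(X) = M_ι(ℚ)`), the skew forms `ψ` with `ψ ∘ (γ × 1) = ψ ∘ (1 × γ†)` for ALL `γ ∈ M_ι(ℚ)` are exactly the rational
multiples of the polarisation `e_{D₀}` — Prop. 1.3 returns `NS_ℚ(X) = ℚ · [E₀]`, in accordance with
`NS_ℚ(X) ≅ End^s_ℚ(X) = ℚ` (Lange Prop. 2.4.12). [cite: Milne1999LefschetzClasses, §1 Prop. 1.3 (p. 643)]
[cite: Lange2023AbelianVarietiesComplex, §2.4.2 Prop. 2.4.12] -/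
theorem IsRiemannForm.forall_transpose_mul_eq_iff_exists_eq_smul (hη₀ : IsRiemannForm Φ η₀)
    (hG₀ : G₀.map (Rat.cast : ℚ → ℝ) = latticeGram Φ η₀) (h : endAlgRat Φ = ⊥) {Ψ : Matrix ι ι ℚ}
    (hΨ : Ψᵀ = -Ψ) :
    (∀ γ : Matrix ι ι ℚ, γᵀ * Ψ = Ψ * rosati G₀ γ) ↔ ∃ c : ℚ, Ψ = c • G₀ := by
  have hdet : IsUnit G₀.det := isUnit_det_of_map_ratCast hG₀ hη₀.isUnit_det_latticeGram
  constructor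
  · intro hall
    obtain ⟨η, hη, hηΨ⟩ := exists_mem_neronSeveriQ_ratGram_eq_of_forall_centralizer hη₀ hG₀ hΨ fun γ _ ↦ hall γ
    -- `φ_{D₀}⁻¹ φ_D = G₀⁻¹ Ψ ∈ End_ℚ(X) = ℚ`
    have hφ := (nsToEnd_mem_symmEndRat hη₀.1 hG₀ hdet ⟨η, hη⟩).1
    rw [h, Algebra.mem_bot] at hφ
    obtain ⟨c, hc⟩ := Set.mem_range.1 hφ
    rw [nsToEnd_apply, Algebra.algebraMap_eq_smul_one] at hc
    refine ⟨c, ?_⟩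
    calc Ψ = G₀ * (G₀⁻¹ * ratGram Φ η) := by rw [Matrix.mul_nonsing_inv_cancel_left _ _ hdet, hηΨ]
      _ = c • G₀ := by rw [← hc, Matrix.mul_smul, Matrix.mul_one]
  · rintro ⟨c, rfl⟩ γ
    rw [Matrix.mul_smul, Matrix.smul_mul, mul_rosati hdet]

/-- The same with the centraliser written out (`C(X) = M_ι(ℚ)` here): for `End_ℚ(X) = ℚ` the `C(X)`-compatible skew
forms are the multiples of `e_{D₀}`. [cite: Milne1999LefschetzClasses, §1 Prop. 1.3 (p. 643)] -/
theorem IsRiemannForm.forall_centralizer_transpose_mul_eq_iff_exists_eq_smul (hη₀ : IsRiemannForm Φ η₀)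
    (hG₀ : G₀.map (Rat.cast : ℚ → ℝ) = latticeGram Φ η₀) (h : endAlgRat Φ = ⊥) {Ψ : Matrix ι ι ℚ}
    (hΨ : Ψᵀ = -Ψ) :
    (∀ γ ∈ Subalgebra.centralizer ℚ (endAlgRat Φ : Set (Matrix ι ι ℚ)), γᵀ * Ψ = Ψ * rosati G₀ γ) ↔
      ∃ c : ℚ, Ψ = c • G₀ := by
  rw [← hη₀.forall_transpose_mul_eq_iff_exists_eq_smul hG₀ h hΨ, centralizer_endAlgRat_eq_top_of_eq_bot Φ h]
  exact ⟨fun h' γ ↦ h' γ Algebra.mem_top, fun h' γ _ ↦ h' γ⟩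

end PicardOne

end ComplexTorus

end Literature.Geometry.Kaehler
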